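import Mathlib
import Summits.AtomisticToContinuum.Crystallization.Theorems.NashClassCertificatesNashNearFieldStubTriLandscapeFarKernel

/-!
# Crux `NashNearField` (16827), stub `stub_triLandscapeFar`: the certified-numerics kernel II —
# real semantics of the kernel data (definitions)

The real objects the computable kernel `Far.lowerBound` (`…FarKernel`) speaks about: real rows and terms
(`RRow`, `RTerm`: `q(t) = Σ_r κ_r ℓ_r(t)²`, `ℓ_r` affine in `t : ℕ → ℝ`, value `w · φ(q(t))`,
`φ(q) = q⁻⁶/12 − q⁻³/6`, `φ'`, `φ''`, the gradient pieces `∇q·d`, `∂_k q`, the curvature `C(d)`, the Hessian `∂²_{kl}q`);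
the enclosure relations (`VMem`, `MMem` for vectors/matrices of intervals, `RowEncl`, `TermEncl`, `BoxEncl`, the box
`InBox`, well-formedness `CTerm.WF`); the loop invariant (`TInv`, `Inv`); the real constraint sums `muEllR`.
Definitions only; the theorems are in `…FarSoundRows`, `…FarSoundAccum`, `…FarSoundCalculus`, `…FarSoundStep`,
`…FarSoundFinal`.
-/

noncomputable section

namespace Summit.AtomisticToContinuum.Crystallization.Theorems.NashClassCertificatesNashNearField

namespace Far

open Literature.Analysis.ValidatedNumerics.Numerics

/-! ### Enclosure of real vectors and matrices by lists of intervals -/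

/-- `G` encloses the real vector `g` entrywise (entries beyond the list must vanish). [folklore] -/
def VMem (G : List FI) (g : ℕ → ℝ) : Prop := ∀ k, FI.mem (g k) (getFI G k)

/-- `H` (36 entries, flat index `6k + l`) encloses the real matrix `h` on `k, l < 6`. [folklore] -/
def MMem (H : List FI) (h : ℕ → ℕ → ℝ) : Prop := ∀ k, k < 6 → ∀ l, l < 6 → FI.mem (h k l) (getFI H (6 * k + l))

/-! ### Real rows and terms -/

/-- A real affine row with its weight: `κ · (Σ_{(k, α)} α t_k + const)²`. [folklore] -/
structure RRow where
  /-- weight -/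
  κ : ℝ
  /-- sparse coefficients -/
  coef : List (ℕ × ℝ)
  /-- constant coefficient -/
  const : ℝ

namespace RRow

/-- `ℓ(t)`. [folklore] -/
def ell (R : RRow) (t : ℕ → ℝ) : ℝ := (R.coef.map fun p => p.2 * t p.1).sum + R.const

/-- The linear part `λ(d) = Σ α_k d_k`. [folklore] -/
def lam (R : RRow) (d : ℕ → ℝ) : ℝ := (R.coef.map fun p => p.2 * d p.1).sum

/-- The total coefficient of variable `k`. [folklore] -/
def coefAt (R : RRow) (k : ℕ) : ℝ := (R.coef.map fun p => if p.1 = k then p.2 else 0).sum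

/-- `Σ |α_k| e_k`, the deviation of the row over a box of half-widths `e`. [folklore] -/
def dev (R : RRow) (e : ℕ → ℝ) : ℝ := (R.coef.map fun p => |p.2| * e p.1).sum

end RRow

/-- A real term `w · φ(Σ_r κ_r ℓ_r(t)²)`. [folklore] -/
structure RTerm where
  /-- signed weight -/
  w : ℝ
  /-- rows -/
  rows : List RRow

/-- `φ(q) = q⁻⁶/12 − q⁻³/6` (`= V_LJ(√q)` for `q > 0`, `tri_lj_sqrt_eq`). [folklore] -/
def phi (q : ℝ) : ℝ := (1 / 12) * q⁻¹ ^ 6 - (1 / 6) * q⁻¹ ^ 3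

/-- `φ'(q) = (q⁻⁴ − q⁻⁷)/2`. [folklore] -/
def phi1 (q : ℝ) : ℝ := (q⁻¹ ^ 4 - q⁻¹ ^ 7) / 2

/-- `φ''(q) = (7/2) q⁻⁸ − 2 q⁻⁵`. [folklore] -/
def phi2 (q : ℝ) : ℝ := 7 / 2 * q⁻¹ ^ 8 - 2 * q⁻¹ ^ 5

namespace RTerm

/-- The squared distance `q(t) = Σ_r κ_r ℓ_r(t)²`. [folklore] -/
def q (T : RTerm) (t : ℕ → ℝ) : ℝ := (T.rows.map fun R => R.κ * R.ell t ^ 2).sum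

/-- The value `w φ(q(t))`. [folklore] -/
def val (T : RTerm) (t : ℕ → ℝ) : ℝ := T.w * phi (T.q t)

/-- `∇q(x)·d = Σ_r 2κ_r ℓ_r(x) λ_r(d)`. [folklore] -/
def gradDot (T : RTerm) (x d : ℕ → ℝ) : ℝ := (T.rows.map fun R => 2 * R.κ * R.ell x * R.lam d).sum

/-- The curvature `C(d) = Σ_r κ_r λ_r(d)² = ½ dᵀ∇²q d`. [folklore] -/
def curv (T : RTerm) (d : ℕ → ℝ) : ℝ := (T.rows.map fun R => R.κ * R.lam d ^ 2).sum

/-- The gradient component `∂_k q(x) = Σ_r 2κ_r α_{rk} ℓ_r(x)` (total coefficient of variable `k`). [folklore] -/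
def dq (T : RTerm) (x : ℕ → ℝ) (k : ℕ) : ℝ := (T.rows.map fun R => 2 * R.κ * R.coefAt k * R.ell x).sum

/-- The Hessian entry `∂²_{kl} q = Σ_r 2κ_r α_{rk} α_{rl}`. [folklore] -/
def hq (T : RTerm) (k l : ℕ) : ℝ := (T.rows.map fun R => 2 * R.κ * R.coefAt k * R.coefAt l).sum

end RTerm

/-! ### Enclosure relations and boxes -/

/-- The computable row encloses the real row. [folklore] -/
def RowEncl (C : CRow) (R : RRow) : Prop :=
  (C.κ : ℝ) = R.κ ∧ List.Forall₂ (fun c r => c.1 = r.1 ∧ FI.mem r.2 c.2) C.coef R.coef ∧ FI.mem R.const C.const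

/-- The computable term encloses the real term. [folklore] -/
def TermEncl (C : CTerm) (T : RTerm) : Prop := (C.w : ℝ) = T.w ∧ List.Forall₂ RowEncl C.rows T.rows

/-- The computable box encloses the real centre `c` and dominates the real half-widths `e`. [folklore] -/
def BoxEncl (B : CBox) (c e : ℕ → ℝ) : Prop :=
  (∀ k, FI.mem (c k) (getFI B.centre k)) ∧ (∀ k, 0 ≤ e k ∧ e k * SC ≤ (B.half.getD k 0 : ℝ))

/-- `t` lies in the box `|t_k − c_k| ≤ e_k` (all coordinates). [folklore] -/
def InBox (c e t : ℕ → ℝ) : Prop := ∀ k, |t k - c k| ≤ e k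

/-! ### Well-formedness, the loop invariant, constraint sums -/

/-- Well-formedness of a computable term (what `wellFormed` checks termwise). [folklore] -/
def CTerm.WF (C : CTerm) : Prop := ∀ R ∈ C.rows, 0 ≤ R.κ ∧ ∀ p ∈ R.coef, p.1 < 6

/-- Per-term content of the invariant: non-negative curvature coefficients and the centred inequality on the
box. [folklore] -/
structure TInv (c e : ℕ → ℝ) (T : RTerm) (m n : ℝ) : Prop where
  /-- `m ≥ 0` -/
  m_nonneg : 0 ≤ m
  /-- `n ≥ 0` -/
  n_nonneg : 0 ≤ n
  /-- all indices `< 6` -/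
  idx : ∀ R ∈ T.rows, ∀ p ∈ R.coef, p.1 < 6
  /-- the centred inequality -/
  bound : ∀ t, InBox c e t →
    T.val c + T.w * phi1 (T.q c) * T.gradDot c (fun k => t k - c k) - n * T.curv (fun k => t k - c k)
      - 1 / 2 * m * (T.q t - T.q c) ^ 2 ≤ T.val t

/-- The loop invariant on a list of (term, `m`, `n`). [folklore] -/
structure Inv (c e : ℕ → ℝ) (L : List (RTerm × ℝ × ℝ)) (S : KState) : Prop where
  /-- lengths -/
  glen : S.grad.length = 6
  /-- lengths -/
  mlen : S.mm.length = 36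
  /-- lengths -/
  nlen : S.nn.length = 36
  /-- value enclosure -/
  val : FI.mem ((L.map fun x => x.1.val c).sum) S.val
  /-- gradient enclosure -/
  grad : VMem S.grad (fun k => (L.map fun x => x.1.w * phi1 (x.1.q c) * x.1.dq c k).sum)
  /-- per-term facts -/
  terms : ∀ x ∈ L, TInv c e x.1 x.2.1 x.2.2
  /-- `mm` enclosure, uniformly in the box -/
  mm : ∀ ξ, InBox c e ξ → MMem S.mm (fun k l => (L.map fun x => x.2.1 * x.1.dq ξ k * x.1.dq ξ l).sum)
  /-- `nn` enclosure -/
  nn : MMem S.nn (fun k l => (L.map fun x => x.2.2 * x.1.hq k l).sum)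

/-- Real versions of the constraint sums. [folklore] -/
def muEllR (cons : List CCons) (k : ℕ) : ℝ := (cons.map fun C => (C.μ : ℝ) * (C.l.getD k 0 : ℝ)).sum


end Far


end Summit.AtomisticToContinuum.Crystallization.Theorems.NashClassCertificatesNashNearField

end
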